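import Literature.Probability.Percolation.SiteCouplingMachine
import Literature.Probability.Percolation.CouplingLift
import HarnessLib

/-!
# Lifting the site exploration to the cover: designated lifts of sites, the current lift of every explored
# vertex, and the vertex two-lift data (Martineau–Severo 2019, §5, site adaptation)

Support file of the inline proof of the site version of Martineau–Severo's Corollary 2.2
(`MartineauSevero2019_cor22_site`, Proposition 4.1); site twin of the tree's `CouplingLift.lean`.
Martineau–Severo (Ann. Probab. 47 (2019), §5 and Remark 4: "This construction adapts to site percolation. The
lift is the same as in [BS96] while the 'multiple edges' trick now consists in defining `Ĝ` as follows: each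
vertex has `M` possible states"). A site `v` of `ℋ` queried from the explored vertex `a` is answered on `𝒢` by
its DESIGNATED lift: the lift of `v` adjacent to the current lift `λ(a)` of `a` (or `λ(a)` itself when the
explored vertex `a = v` queries its own state); the far endpoint of an open query becomes the lift of `v`. A
bonus at `u` is answered by fresh coins on the witness vertices `Z(x, r)` around the lift `x = λ(u)` together
with, for every vertex `v` of `S_{r+1}(u)`, one of TWO DISTINCT lifts `tip₁ ≠ tip₂` of `v` adjacent to `Z(x,r)`
(Lemma 5.1, vertex form: translate by the tame group element; distinct by freeness), of which at most one is
the designated lift of `v`; its tip becomes the lift of `v`.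

* `SiteCoupling.desigV` — the designated lift of a site queried as `(a, v)`;
* `SiteCoupling.SiteTwoLiftData` — the witness vertices `wt x` and, for every sphere vertex `v`, the base,
  two feet in `wt x` joined to `x` inside `wt x`, and two distinct tips over `v`
  (`SiteTwoLiftData.ofTame` from `exists_siteTwoLiftWitness`);
* `SiteCoupling.lamOf` — the current lift `λ_b : V(ℋ) → V(𝒢)` after the transcript `b`; `SiteCoupling.pick`;
* the structural facts: `λ` frozen on explored vertices, designated lifts stable and projecting to their sites
  (`inv_lift`, `qmk_lamOf`, `qmk_desig`), and the candidates of a bonus project into queried sites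
  (`cand_proj_mem_Qd`).

## References

* S. Martineau, F. Severo, Ann. Probab. 47 (2019), §5 (Conditions ①–⑤; Steps `2K+1`, `2K+2`; Lemma 5.1;
  Remark 4) and §7 (Lemmas 7.1, 7.2) [MartineauSevero2019].
-/

noncomputable section

namespace Literature.Probability.Percolation

open Literature.Barriers.CriticalPhenomena Coupling
open scoped Classical

namespace SiteCoupling

variable {V : Type*} {Γ : Type*} [Group Γ] [MulAction Γ V]

/-! ### Designated lifts of sites -/

section Desig

variable (G : SimpleGraph V) (Γ)

/-- The designated lift of a site queried as the ordered pair `(a, v)`, given the current lifts: the current lift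
of `a` itself if `v = a`, else the lift of `v` adjacent to it (weak lifting).
[cite: MartineauSevero2019, §5 (Condition ①) and Remark 4 ("the lift is the same as in [BS96]")] -/
def desigV (lam : MulAction.orbitRel.Quotient Γ V → V)
    (av : MulAction.orbitRel.Quotient Γ V × MulAction.orbitRel.Quotient Γ V) : V :=
  if av.2 = av.1 then lam av.1 else edgeLift Γ G (lam av.1) av.2

variable {G Γ}

/-- The designated lift projects to the queried site and is the lift of the source or adjacent to it.
[cite: MartineauSevero2019, §2 (weak lifting property)] -/
theorem desigV_spec (hact : IsActionByAut G Γ) {lam : MulAction.orbitRel.Quotient Γ V → V}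
    {a v : MulAction.orbitRel.Quotient Γ V} (ha : qmk Γ (lam a) = a) (h : v = a ∨ (orbitQuotientGraph G Γ).Adj a v) :
    qmk Γ (desigV Γ G lam (a, v)) = v ∧ (desigV Γ G lam (a, v) = lam a ∨ G.Adj (lam a) (desigV Γ G lam (a, v))) := by
  unfold desigV
  dsimp only
  by_cases hva : v = a
  · rw [if_pos hva]
    subst hva
    exact ⟨ha, Or.inl rfl⟩
  · rw [if_neg hva]
    have hadj : (orbitQuotientGraph G Γ).Adj (qmk Γ (lam a)) v := by
      rw [ha]; exact h.resolve_left hva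
    obtain ⟨h1, h2⟩ := edgeLift_spec hact hadj
    exact ⟨h2, Or.inr h1⟩

end Desig

/-! ### The vertex two-lift data -/

section Data

variable (G : SimpleGraph V) (Γ) (r : ℕ)

/-- **The witness structure of a bonus (vertex form)**, chosen once and for all for every possible lift `x`: the
witness vertices `wt x` and, for every vertex `v` of the sphere `S_{r+1}(π x)`, an `ℋ`-neighbour `base x v` in
`S_r(π x)`, two feet over it in `wt x` joined to `x` by walks inside `wt x`, and two DISTINCT tips over `v`
adjacent to the respective feet. [cite: MartineauSevero2019, §5 (Lemma 5.1; Step 2K+2; Remark 4)] -/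
structure SiteTwoLiftData where
  /-- the witness vertices around the lift `x` -/
  wt : V → Finset V
  /-- the neighbour of the sphere vertex `v` at distance `r` -/
  base : V → MulAction.orbitRel.Quotient Γ V → MulAction.orbitRel.Quotient Γ V
  /-- the foot of the first candidate lift -/
  foot₁ : V → MulAction.orbitRel.Quotient Γ V → V
  /-- the first candidate lift of `v` -/
  tip₁ : V → MulAction.orbitRel.Quotient Γ V → V
  /-- the foot of the second candidate lift -/
  foot₂ : V → MulAction.orbitRel.Quotient Γ V → V
  /-- the second candidate lift of `v` -/
  tip₂ : V → MulAction.orbitRel.Quotient Γ V → V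
  wt_ball : ∀ x, ∀ z ∈ wt x, z ∈ graphBall G x (3 * r) ∧ qmk Γ z ∈ graphBall (orbitQuotientGraph G Γ) (qmk Γ x) r
  wt_card : ∀ x, (wt x).card ≤ (4 * r + 3) * ballVolume (orbitQuotientGraph G Γ) (qmk Γ x) (r + 1)
  spec : ∀ x v, (orbitQuotientGraph G Γ).dist (qmk Γ x) v = r + 1 →
    (orbitQuotientGraph G Γ).dist (qmk Γ x) (base x v) = r ∧ (orbitQuotientGraph G Γ).Adj (base x v) v ∧
    qmk Γ (foot₁ x v) = base x v ∧ qmk Γ (foot₂ x v) = base x v ∧ qmk Γ (tip₁ x v) = v ∧ qmk Γ (tip₂ x v) = v ∧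
    G.Adj (foot₁ x v) (tip₁ x v) ∧ G.Adj (foot₂ x v) (tip₂ x v) ∧ tip₁ x v ≠ tip₂ x v ∧
    foot₁ x v ∈ wt x ∧ foot₂ x v ∈ wt x ∧
    (∃ p : G.Walk x (foot₁ x v), ∀ z ∈ p.support, z ∈ wt x) ∧
    (∃ p : G.Walk x (foot₂ x v), ∀ z ∈ p.support, z ∈ wt x)

variable {G Γ r}

/-- **The witness for one sphere vertex (vertex form).** Given `g` with `g x ≠ x`, `g x ∈ B_{2r}(x)` and a vertex
`v` at distance `r + 1` from `π x`: an `ℋ`-neighbour `w` of `v` at distance `r`, two lifts `v₁ ≠ v₂ = g v₁` of `v`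
adjacent to lifts `z₁, z₂ = g z₁` of `w`, and a finite set `F` of witness vertices (the supports of a lifted
geodesic `P` from `x` to `z₁`, of a walk from `x` to `g x`, and of `g P`) containing `z₁, z₂` and walks from `x`
to them, all inside `B_{3r}(x) ∩ π⁻¹(B_r(π x))`, with `|F| ≤ 4r + 3`.
[cite: MartineauSevero2019, §5 Lemma 5.1 (proof) and Remark 4] -/
theorem exists_siteTwoLifts_at [G.LocallyFinite] (hG : G.Connected)
    (hact : IsActionByAut G Γ) (hfree : ∀ (g : Γ) (x : V), g • x = x → g = 1) {x : V} {g : Γ}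
    (hgx : g • x ≠ x) (hgB : g • x ∈ graphBall G x (2 * r))
    {v : MulAction.orbitRel.Quotient Γ V} (hv : (orbitQuotientGraph G Γ).dist (qmk Γ x) v = r + 1) :
    ∃ (F : Finset V) (w : MulAction.orbitRel.Quotient Γ V) (z₁ v₁ z₂ v₂ : V),
      (∀ z ∈ F, z ∈ graphBall G x (3 * r) ∧ qmk Γ z ∈ graphBall (orbitQuotientGraph G Γ) (qmk Γ x) r) ∧
      F.card ≤ 4 * r + 3 ∧
      (orbitQuotientGraph G Γ).dist (qmk Γ x) w = r ∧ (orbitQuotientGraph G Γ).Adj w v ∧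
      qmk Γ z₁ = w ∧ qmk Γ z₂ = w ∧ qmk Γ v₁ = v ∧ qmk Γ v₂ = v ∧
      G.Adj z₁ v₁ ∧ G.Adj z₂ v₂ ∧ v₁ ≠ v₂ ∧ z₁ ∈ F ∧ z₂ ∈ F ∧
      (∃ p : G.Walk x z₁, ∀ z ∈ p.support, z ∈ F) ∧ (∃ p : G.Walk x z₂, ∀ z ∈ p.support, z ∈ F) := by
  classical
  set H := orbitQuotientGraph G Γ with hHdef
  have hH : H.Connected := quot_connected hG
  -- the neighbour `w` of `v` at distance `r` on a geodesic from `π x`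
  obtain ⟨w, hwv, hw⟩ := exists_adj_mem_graphBall_of_dist_eq hH hv
  have hwdist : H.dist (qmk Γ x) w = r := by
    have h1 : H.dist (qmk Γ x) w ≤ r := dist_le_of_mem_graphBall hw
    have h2 := hH.dist_triangle (u := qmk Γ x) (v := w) (w := v)
    rw [SimpleGraph.dist_eq_one_iff_adj.2 hwv, hv] at h2
    omega
  -- lift a geodesic to `w`, then the edge `{w, v}`
  obtain ⟨wH, hwH⟩ := hH.exists_walk_length_eq_dist (qmk Γ x) w
  obtain ⟨z₁, hz₁, P, hP⟩ := exists_lift_walk hact wH rfl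
  obtain ⟨v₁, hz₁v₁, hv₁⟩ := exists_adj_of_quot_adj hact (x := z₁) (u := v) (by rw [hz₁]; exact hwv)
  -- a walk from `x` to `g x`
  obtain ⟨γ, hγ⟩ := hgB
  -- the translated walk
  set gP : G.Walk (g • x) (g • z₁) := P.map (smulIso hact g).toHom with hgP
  have hPlen : P.length = r := by rw [hP, hwH, hwdist]
  have hgPlen : gP.length = r := (SimpleGraph.Walk.length_map _ _).trans hPlen
  -- the witness vertices
  set F : Finset V := P.support.toFinset ∪ γ.support.toFinset ∪ gP.support.toFinset with hFdef
  have hPF : ∀ z ∈ P.support, z ∈ F := fun z hz => by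
    simp only [hFdef, Finset.mem_union, List.mem_toFinset]; exact Or.inl (Or.inl hz)
  have hγF : ∀ z ∈ γ.support, z ∈ F := fun z hz => by
    simp only [hFdef, Finset.mem_union, List.mem_toFinset]; exact Or.inl (Or.inr hz)
  have hgPF : ∀ z ∈ gP.support, z ∈ F := fun z hz => by
    simp only [hFdef, Finset.mem_union, List.mem_toFinset]; exact Or.inr hz
  refine ⟨F, w, z₁, v₁, g • z₁, g • v₁, ?_, ?_, hwdist, hwv, hz₁, by rw [qmk_smul, hz₁], hv₁,
    by rw [qmk_smul, hv₁], hz₁v₁, (hact g z₁ v₁).2 hz₁v₁, ?_, hPF _ P.end_mem_support, hgPF _ gP.end_mem_support,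
    ⟨P, hPF⟩, ⟨γ.append gP, fun z hz => ?_⟩⟩
  · -- witness vertices in `B_{3r}(x)` projecting into `B_r(π x)`
    intro z hz
    simp only [hFdef, Finset.mem_union, List.mem_toFinset] at hz
    rcases hz with (hzs | hzs) | hzs
    · refine ⟨graphBall_mono _ _ (by omega) (support_subset_graphBall_start P hzs), ?_⟩
      have := qmk_mem_graphBall_of_walk (Γ := Γ) (P.takeUntil z hzs)
      exact graphBall_mono _ _ ((P.length_takeUntil_le_length hzs).trans hPlen.le) this
    · exact ⟨graphBall_mono _ _ (by omega) ((support_subset_graphBall_start γ hzs) |>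
        graphBall_mono _ _ hγ), qmk_support_mem_graphBall γ hγ (qmk_smul Γ g x) hzs⟩
    · have hzs' : g⁻¹ • z ∈ P.support := (mem_support_map_smulIso_iff hact g P).1 hzs
      constructor
      · have h1 : z ∈ graphBall G (g • x) gP.length := support_subset_graphBall_start gP hzs
        rw [hgPlen] at h1
        have := mem_graphBall_trans ⟨γ, hγ⟩ h1
        exact graphBall_mono _ _ (by omega) this
      · have := qmk_mem_graphBall_of_walk (Γ := Γ) (P.takeUntil _ hzs')
        have h2 := graphBall_mono _ _ ((P.length_takeUntil_le_length hzs').trans hPlen.le) this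
        rw [qmk_smul] at h2
        exact h2
  · -- cardinality
    have h1 : P.support.toFinset.card ≤ r + 1 :=
      (List.toFinset_card_le _).trans (by rw [SimpleGraph.Walk.length_support, hPlen])
    have h2 : γ.support.toFinset.card ≤ 2 * r + 1 :=
      (List.toFinset_card_le _).trans (by rw [SimpleGraph.Walk.length_support]; omega)
    have h3 : gP.support.toFinset.card ≤ r + 1 :=
      (List.toFinset_card_le _).trans (by rw [SimpleGraph.Walk.length_support, hgPlen])
    calc F.card ≤ (P.support.toFinset ∪ γ.support.toFinset).card + gP.support.toFinset.card := Finset.card_union_le _ _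
      _ ≤ P.support.toFinset.card + γ.support.toFinset.card + gP.support.toFinset.card :=
          Nat.add_le_add_right (Finset.card_union_le _ _) _
      _ ≤ 4 * r + 3 := by omega
  · -- the two tips are distinct (freeness)
    intro heq
    have : g = 1 := hfree g v₁ heq.symm
    subst this
    exact hgx (one_smul _ _)
  · -- support of `γ.append gP`
    rw [SimpleGraph.Walk.mem_support_append_iff] at hz
    rcases hz with hz | hz
    · exact hγF z hz
    · exact hgPF z hz

/-- **The vertex two-lift witness (Lemma 5.1, vertex form, for the quotient map of a free action).** With
`R ≤ 2r` from tame fibres: for every `x` a finite set `Wt` of witness vertices, all in `B_{3r}(x)` projecting into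
`B_r(π x)`, of cardinality `≤ (4r+3) |B_{r+1}(π x)|`, such that every vertex `v` of the sphere `S_{r+1}(π x)` has an
`ℋ`-neighbour `w ∈ S_r(π x)` and two distinct lifts `v₁ ≠ v₂`, adjacent to feet `z₁, z₂ ∈ Wt` over `w` joined to
`x` inside `Wt`. In the coupling, at most one of the two lifts is designated, so a fresh one exists.
[cite: MartineauSevero2019, §5 Lemma 5.1, Step 2K+2 and Remark 4] -/
theorem exists_siteTwoLiftWitness [G.LocallyFinite] (hG : G.Connected)
    (hact : IsActionByAut G Γ) (hfree : ∀ (g : Γ) (x : V), g • x = x → g = 1) {R : ℕ}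
    (hRr : R ≤ 2 * r) (hR : ∀ x, ∃ g : Γ, g • x ≠ x ∧ g • x ∈ graphBall G x R) (x : V) :
    ∃ Wt : Finset V,
      (∀ z ∈ Wt, z ∈ graphBall G x (3 * r) ∧ qmk Γ z ∈ graphBall (orbitQuotientGraph G Γ) (qmk Γ x) r) ∧
      Wt.card ≤ (4 * r + 3) * ballVolume (orbitQuotientGraph G Γ) (qmk Γ x) (r + 1) ∧
      ∀ v, (orbitQuotientGraph G Γ).dist (qmk Γ x) v = r + 1 →
        ∃ (w : MulAction.orbitRel.Quotient Γ V) (z₁ v₁ z₂ v₂ : V),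
          (orbitQuotientGraph G Γ).dist (qmk Γ x) w = r ∧ (orbitQuotientGraph G Γ).Adj w v ∧
          qmk Γ z₁ = w ∧ qmk Γ z₂ = w ∧ qmk Γ v₁ = v ∧ qmk Γ v₂ = v ∧
          G.Adj z₁ v₁ ∧ G.Adj z₂ v₂ ∧ v₁ ≠ v₂ ∧ z₁ ∈ Wt ∧ z₂ ∈ Wt ∧
          (∃ p : G.Walk x z₁, ∀ z ∈ p.support, z ∈ Wt) ∧ (∃ p : G.Walk x z₂, ∀ z ∈ p.support, z ∈ Wt) := by
  classical
  set H := orbitQuotientGraph G Γ with hHdef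
  haveI : H.LocallyFinite := quotLocallyFinite hact
  obtain ⟨g, hgx, hgB⟩ := hR x
  have hgB' : g • x ∈ graphBall G x (2 * r) := graphBall_mono _ _ hRr hgB
  set S : Finset (MulAction.orbitRel.Quotient Γ V) :=
    (graphBall_finite H (qmk Γ x) (r + 1)).toFinset.filter fun v => H.dist (qmk Γ x) v = r + 1 with hSdef
  have hSmem : ∀ v, v ∈ S ↔ H.dist (qmk Γ x) v = r + 1 := by
    intro v
    rw [hSdef, Finset.mem_filter, Set.Finite.mem_toFinset]
    constructor
    · exact fun h => h.2
    · intro h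
      exact ⟨mem_graphBall_of_dist_le (quot_connected hG) h.le, h⟩
  have key : ∀ v : MulAction.orbitRel.Quotient Γ V, ∃ F : Finset V,
      H.dist (qmk Γ x) v = r + 1 →
      ∃ (w : MulAction.orbitRel.Quotient Γ V) (z₁ v₁ z₂ v₂ : V),
        (∀ z ∈ F, z ∈ graphBall G x (3 * r) ∧ qmk Γ z ∈ graphBall H (qmk Γ x) r) ∧
        F.card ≤ 4 * r + 3 ∧
        H.dist (qmk Γ x) w = r ∧ H.Adj w v ∧
        qmk Γ z₁ = w ∧ qmk Γ z₂ = w ∧ qmk Γ v₁ = v ∧ qmk Γ v₂ = v ∧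
        G.Adj z₁ v₁ ∧ G.Adj z₂ v₂ ∧ v₁ ≠ v₂ ∧ z₁ ∈ F ∧ z₂ ∈ F ∧
        (∃ p : G.Walk x z₁, ∀ z ∈ p.support, z ∈ F) ∧ (∃ p : G.Walk x z₂, ∀ z ∈ p.support, z ∈ F) := by
    intro v
    by_cases hv : H.dist (qmk Γ x) v = r + 1
    · obtain ⟨F, w, z₁, v₁, z₂, v₂, h⟩ := exists_siteTwoLifts_at hG hact hfree hgx hgB' hv
      exact ⟨F, fun _ => ⟨w, z₁, v₁, z₂, v₂, h⟩⟩
    · exact ⟨∅, fun h => absurd h hv⟩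
  choose F hF using key
  set Wt : Finset V := S.biUnion F with hWt
  have hFsub : ∀ v ∈ S, F v ⊆ Wt := fun v hv => Finset.subset_biUnion_of_mem F hv
  refine ⟨Wt, ?_, ?_, ?_⟩
  · intro z hz
    rw [hWt, Finset.mem_biUnion] at hz
    obtain ⟨v, hv, hz⟩ := hz
    exact (hF v ((hSmem v).1 hv)).choose_spec.choose_spec.choose_spec.choose_spec.choose_spec.1 z hz
  · calc Wt.card ≤ ∑ v ∈ S, (F v).card := Finset.card_biUnion_le
      _ ≤ ∑ _v ∈ S, (4 * r + 3) := Finset.sum_le_sum fun v hv =>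
          (hF v ((hSmem v).1 hv)).choose_spec.choose_spec.choose_spec.choose_spec.choose_spec.2.1
      _ = S.card * (4 * r + 3) := by rw [Finset.sum_const, smul_eq_mul]
      _ ≤ ballVolume H (qmk Γ x) (r + 1) * (4 * r + 3) := by
          refine Nat.mul_le_mul_right _ ?_
          rw [ballVolume, Set.ncard_eq_toFinset_card _ (graphBall_finite H (qmk Γ x) (r + 1)), hSdef]
          exact Finset.card_filter_le _ _
      _ = (4 * r + 3) * ballVolume H (qmk Γ x) (r + 1) := by ring
  · intro v hv
    obtain ⟨w, z₁, v₁, z₂, v₂, -, -, h4, h5, h6, h7, h8, h9, h10, h11, h12, h13, h14, h15, h16⟩ := hF v hv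
    have hsub := hFsub v ((hSmem v).2 hv)
    obtain ⟨p₁, hp₁⟩ := h15
    obtain ⟨p₂, hp₂⟩ := h16
    exact ⟨w, z₁, v₁, z₂, v₂, h4, h5, h6, h7, h8, h9, h10, h11, h12, hsub h13, hsub h14,
      ⟨p₁, fun z hz => hsub (hp₁ z hz)⟩, ⟨p₂, fun z hz => hsub (hp₂ z hz)⟩⟩

/-- **The vertex two-lift data exist** for the quotient map of a free action with tame fibres (`R ≤ 2r`).
[cite: MartineauSevero2019, §5 Lemma 5.1 and Remark 4] -/
theorem nonempty_siteTwoLiftData [G.LocallyFinite] (hG : G.Connected) (hact : IsActionByAut G Γ)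
    (hfree : ∀ (g : Γ) (x : V), g • x = x → g = 1) {R : ℕ} (hRr : R ≤ 2 * r)
    (hR : ∀ x, ∃ g : Γ, g • x ≠ x ∧ g • x ∈ graphBall G x R) : Nonempty (SiteTwoLiftData Γ G r) := by
  have key := fun x => exists_siteTwoLiftWitness hG hact hfree hRr hR x
  choose wt hball hcard hv using key
  have hv' : ∀ x v, ∃ (w : MulAction.orbitRel.Quotient Γ V) (z₁ v₁ z₂ v₂ : V),
      (orbitQuotientGraph G Γ).dist (qmk Γ x) v = r + 1 →
      (orbitQuotientGraph G Γ).dist (qmk Γ x) w = r ∧ (orbitQuotientGraph G Γ).Adj w v ∧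
      qmk Γ z₁ = w ∧ qmk Γ z₂ = w ∧ qmk Γ v₁ = v ∧ qmk Γ v₂ = v ∧
      G.Adj z₁ v₁ ∧ G.Adj z₂ v₂ ∧ v₁ ≠ v₂ ∧ z₁ ∈ wt x ∧ z₂ ∈ wt x ∧
      (∃ p : G.Walk x z₁, ∀ z ∈ p.support, z ∈ wt x) ∧ (∃ p : G.Walk x z₂, ∀ z ∈ p.support, z ∈ wt x) := by
    intro x v
    by_cases h : (orbitQuotientGraph G Γ).dist (qmk Γ x) v = r + 1
    · obtain ⟨w, z₁, v₁, z₂, v₂, hh⟩ := hv x v h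
      exact ⟨w, z₁, v₁, z₂, v₂, fun _ => hh⟩
    · exact ⟨qmk Γ x, x, x, x, x, fun h' => absurd h' h⟩
  choose base foot₁ tip₁ foot₂ tip₂ hspec using hv'
  exact ⟨⟨wt, base, foot₁, tip₁, foot₂, tip₂, hball, hcard, fun x v h => hspec x v h⟩⟩

/-- A choice of vertex two-lift data. [cite: MartineauSevero2019, §5 Lemma 5.1 and Remark 4] -/
def SiteTwoLiftData.ofTame [G.LocallyFinite] (hG : G.Connected) (hact : IsActionByAut G Γ)
    (hfree : ∀ (g : Γ) (x : V), g • x = x → g = 1) {R : ℕ} (hRr : R ≤ 2 * r)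
    (hR : ∀ x, ∃ g : Γ, g • x ≠ x ∧ g • x ∈ graphBall G x R) : SiteTwoLiftData Γ G r :=
  (nonempty_siteTwoLiftData hG hact hfree hRr hR).some

end Data

/-! ### The lift along a transcript -/

section Lift

variable {G : SimpleGraph V} [(orbitQuotientGraph G Γ).LocallyFinite] {r : ℕ}
  (S : SiteTwoLiftData Γ G r) (x₀ : V) (L N : ℕ)

variable (G) in
/-- The designated lifts of the queried sites of a state, given the current lifts.
[cite: MartineauSevero2019, §5 (Condition ①)] -/
def desigSet (σ : SHState (MulAction.orbitRel.Quotient Γ V)) (lam : MulAction.orbitRel.Quotient Γ V → V) : Finset V :=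
  σ.Qd.image fun v => desigV Γ G lam (σ.src v)

/-- The current lifts of the explored vertices of a state. [cite: MartineauSevero2019, §5 (C')] -/
def lamSet (σ : SHState (MulAction.orbitRel.Quotient Γ V)) (lam : MulAction.orbitRel.Quotient Γ V → V) : Finset V :=
  σ.A.image lam

/-- The two candidate lifts of the sphere vertex `v` around the lift `x`. [cite: MartineauSevero2019, §5 (Step 2K+2)] -/
def candPair (x : V) (v : MulAction.orbitRel.Quotient Γ V) : Finset V := {S.tip₁ x v, S.tip₂ x v}

/-- All candidate vertices of a bonus at `u` lifted at `x`: the witness vertices and the candidate lifts of the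
sphere vertices. [cite: MartineauSevero2019, §5 (Step 2K+2: Z(x,r) and the lifts over S_{r+1}(u))] -/
def cand (x : V) (u : MulAction.orbitRel.Quotient Γ V) : Finset V :=
  S.wt x ∪ (sphereF (orbitQuotientGraph G Γ) u (r + 1)).biUnion fun v => candPair S x v

/-- The candidate lift chosen for the sphere vertex `v` at a bonus of `u` (lift `x = lam u`): the first tip
unless it is currently designated. [cite: MartineauSevero2019, §5 (Step 2K+2: "at least one lift … p-unexplored")] -/
def pick (σ : SHState (MulAction.orbitRel.Quotient Γ V)) (lam : MulAction.orbitRel.Quotient Γ V → V)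
    (u v : MulAction.orbitRel.Quotient Γ V) : V :=
  if S.tip₁ (lam u) v ∈ desigSet G σ lam then S.tip₂ (lam u) v else S.tip₁ (lam u) v

/-- The lifts after a successful bonus of `u`: old lifts are kept, a new sphere vertex is lifted to its chosen
candidate. [cite: MartineauSevero2019, §5 (C'_{2K+2,n+1})] -/
def bonusLam (σ : SHState (MulAction.orbitRel.Quotient Γ V)) (lam : MulAction.orbitRel.Quotient Γ V → V)
    (u : MulAction.orbitRel.Quotient Γ V) : MulAction.orbitRel.Quotient Γ V → V := fun v =>
  if v ∈ σ.A then lam v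
  else if v ∈ sphereF (orbitQuotientGraph G Γ) u (r + 1) then pick S σ lam u v else lam v

/-- **The lifts along a transcript**: a newly explored queried site is lifted to its designated lift; the
vertices conquered by a bonus are lifted to their chosen candidates.
[cite: MartineauSevero2019, §5 (C'_{2K+1,n+1}; C'_{2K+2,n+1}); Remark 4] -/
def lamOf : List Bool → MulAction.orbitRel.Quotient Γ V → V
  | [] => fun _ => x₀
  | b :: bs =>
    match nq (orbitQuotientGraph G Γ) (qmk Γ x₀) r L (stateOf (orbitQuotientGraph G Γ) (qmk Γ x₀) r L N bs) with
    | none => lamOf bs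
    | some (Query.edge a v) =>
      if b = true ∧ v ∉ (stateOf (orbitQuotientGraph G Γ) (qmk Γ x₀) r L N bs).A then
        Function.update (lamOf bs) v (desigV Γ G (lamOf bs) (a, v))
      else lamOf bs
    | some (Query.bonus u) =>
      if b = true then bonusLam S (stateOf (orbitQuotientGraph G Γ) (qmk Γ x₀) r L N bs) (lamOf bs) u else lamOf bs

variable {S x₀ L N}

local notation "Hq" => orbitQuotientGraph G Γ
local notation "stOf" => stateOf (orbitQuotientGraph G Γ) (qmk Γ x₀) r L N

/-- Unfolding `lamOf` on a cons. [cite: MartineauSevero2019, §5 (Structure of the process)] -/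
theorem lamOf_cons (b : Bool) (bs : List Bool) :
    lamOf S x₀ L N (b :: bs) =
      match nq Hq (qmk Γ x₀) r L (stOf bs) with
      | none => lamOf S x₀ L N bs
      | some (Query.edge a v) =>
        if b = true ∧ v ∉ (stOf bs).A then Function.update (lamOf S x₀ L N bs) v (desigV Γ G (lamOf S x₀ L N bs) (a, v))
        else lamOf S x₀ L N bs
      | some (Query.bonus u) =>
        if b = true then bonusLam S (stOf bs) (lamOf S x₀ L N bs) u else lamOf S x₀ L N bs := rfl

/-- **Lifts are frozen on explored vertices.** [cite: MartineauSevero2019, §5 (the lift of an explored vertex never changes)] -/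
theorem lamOf_cons_of_mem_A (b : Bool) (bs : List Bool) {v : MulAction.orbitRel.Quotient Γ V}
    (hv : v ∈ (stOf bs).A) : lamOf S x₀ L N (b :: bs) v = lamOf S x₀ L N bs v := by
  rw [lamOf_cons]
  cases hq : nq Hq (qmk Γ x₀) r L (stOf bs) with
  | none => rfl
  | some q =>
    cases q with
    | edge u w =>
      simp only
      split_ifs with h
      · have hne : v ≠ w := fun h' => h.2 (h' ▸ hv)
        rw [Function.update_of_ne hne]
      · rfl
    | bonus u =>
      simp only
      split_ifs with h
      · simp [bonusLam, hv]
      · rfl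

/-- Lifts are frozen on explored vertices along any extension of the transcript. [cite: MartineauSevero2019, §5] -/
theorem lamOf_append_of_mem_A (b' bs : List Bool) {v : MulAction.orbitRel.Quotient Γ V}
    (hv : v ∈ (stOf bs).A) : lamOf S x₀ L N (b' ++ bs) v = lamOf S x₀ L N bs v := by
  induction b' with
  | nil => rfl
  | cons a b' ih =>
    rw [List.cons_append, lamOf_cons_of_mem_A a (b' ++ bs) ((mono_append b' bs).1 hv), ih]

variable (S x₀ L N) in
/-- The designated lift of a queried site, read off the current state and lifts. [cite: MartineauSevero2019, §5 (Condition ①)] -/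
def desig (bs : List Bool) (v : MulAction.orbitRel.Quotient Γ V) : V :=
  desigV Γ G (lamOf S x₀ L N bs) ((stOf bs).src v)

/-- **Designated lifts are stable**: for a queried site, extending the transcript does not change its designated
lift. [cite: MartineauSevero2019, §5 (Condition ①)] -/
theorem desig_append (hH : (Hq).Connected) (b' bs : List Bool) {v : MulAction.orbitRel.Quotient Γ V}
    (hv : v ∈ (stOf bs).Qd) : desig S x₀ L N (b' ++ bs) v = desig S x₀ L N bs v := by
  have hsrc := (mono_append (H := Hq) (o := qmk Γ x₀) (r := r) (L := L) (N := N) b' bs).2.2.2.2 v hv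
  have hA : ((stOf bs).src v).1 ∈ (stOf bs).A := ((inv_stateOf hH bs).Qd_src v hv).2.2.1
  unfold desig
  rw [hsrc]
  unfold desigV
  rw [lamOf_append_of_mem_A b' bs hA]

/-- Membership in `desigSet`. [cite: MartineauSevero2019, §5 (Condition ①)] -/
theorem mem_desigSet_iff {bs : List Bool} {t : V} :
    t ∈ desigSet G (stOf bs) (lamOf S x₀ L N bs) ↔ ∃ v ∈ (stOf bs).Qd, desig S x₀ L N bs v = t := by
  simp [desigSet, desig]

/-- Membership in `lamSet`. [cite: MartineauSevero2019, §5 (C')] -/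
theorem mem_lamSet_iff {σ : SHState (MulAction.orbitRel.Quotient Γ V)} {lam : MulAction.orbitRel.Quotient Γ V → V} {t : V} :
    t ∈ lamSet σ lam ↔ ∃ v ∈ σ.A, lam v = t := by
  simp [lamSet]

/-! ### Projections of lifts -/

/-- **Lifts project to their vertices** and the invariants of the designated lifts: along every transcript,
`π (λ v) = v` for explored `v`, and the designated lift of a queried site `v` projects to `v` and is the lift of its
source or adjacent to it. [cite: MartineauSevero2019, §5 (Condition ⑤: "π induces a well-defined surjection from C' to C")] -/
theorem inv_lift (hG : G.Connected) (hact : IsActionByAut G Γ) (bs : List Bool) :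
    (∀ v ∈ (stOf bs).A, qmk Γ (lamOf S x₀ L N bs v) = v) ∧
    (∀ v ∈ (stOf bs).Qd, qmk Γ (desig S x₀ L N bs v) = v ∧
      (desig S x₀ L N bs v = lamOf S x₀ L N bs ((stOf bs).src v).1 ∨
        G.Adj (lamOf S x₀ L N bs ((stOf bs).src v).1) (desig S x₀ L N bs v))) := by
  have hH : (Hq).Connected := quot_connected hG
  induction bs with
  | nil =>
    constructor
    · intro v hv
      simp only [stateOf, TExplore.stateOf, machine, SHState.init, Finset.mem_singleton] at hv
      subst hv
      rfl
    · intro v hv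
      simp [stateOf, TExplore.stateOf, machine, SHState.init] at hv
  | cons a bs ih =>
    obtain ⟨ihA, ihQ⟩ := ih
    have hinv := inv_stateOf (H := Hq) (o := qmk Γ x₀) (r := r) (L := L) (N := N) hH bs
    have hmono := mono_cons (H := Hq) (o := qmk Γ x₀) (r := r) (L := L) (N := N) a bs
    -- designated lifts of old queried sites are unchanged, and so are the lifts of their sources
    have hQold : ∀ v ∈ (stOf bs).Qd, qmk Γ (desig S x₀ L N (a :: bs) v) = v ∧
        (desig S x₀ L N (a :: bs) v = lamOf S x₀ L N (a :: bs) ((stOf (a :: bs)).src v).1 ∨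
          G.Adj (lamOf S x₀ L N (a :: bs) ((stOf (a :: bs)).src v).1) (desig S x₀ L N (a :: bs) v)) := by
      intro v hv
      have h1 := desig_append (S := S) hH [a] bs hv
      rw [List.singleton_append] at h1
      have hsrc : (stOf (a :: bs)).src v = (stOf bs).src v := hmono.2.2.2.2 v hv
      have hA : ((stOf bs).src v).1 ∈ (stOf bs).A := (hinv.Qd_src v hv).2.2.1
      rw [h1, hsrc, lamOf_cons_of_mem_A a bs hA]
      exact ihQ v hv
    have hAold : ∀ v ∈ (stOf bs).A, qmk Γ (lamOf S x₀ L N (a :: bs) v) = v := by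
      intro v hv
      rw [lamOf_cons_of_mem_A a bs hv]
      exact ihA v hv
    cases hq : nq Hq (qmk Γ x₀) r L (stOf bs) with
    | none =>
      rw [stateOf_cons_of_none hq]
      refine ⟨hAold, fun v hv => ?_⟩
      have := hQold v hv
      rw [stateOf_cons_of_none hq] at this
      exact this
    | some q =>
      rw [stateOf_cons_of_some hq]
      cases q with
      | edge u w =>
        obtain ⟨hu, huw, hd, hQ⟩ := nq_edge_spec hq
        have hux : qmk Γ (lamOf S x₀ L N bs u) = u := ihA u hu
        have hdes := desigV_spec hact (lam := lamOf S x₀ L N bs) hux huw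
        constructor
        · intro v hv
          rcases mem_A_hstep_edge.1 hv with hv | ⟨ha, rfl⟩
          · exact hAold v hv
          · by_cases hvA : v ∈ (stOf bs).A
            · exact hAold v hvA
            · rw [lamOf_cons, hq]
              simp only [ha, hvA, not_false_eq_true, and_self, if_true, Function.update_self]
              exact hdes.1
        · intro v hv
          rcases mem_Qd_hstep_edge.1 hv with rfl | hv
          · -- the new site
            have hsrc : (hstep Hq r (stOf bs) (Query.edge u v) a).src v = (u, v) := src_hstep_edge_self
            have hlam : lamOf S x₀ L N (a :: bs) u = lamOf S x₀ L N bs u := lamOf_cons_of_mem_A a bs hu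
            unfold desig
            rw [stateOf_cons_of_some hq, hsrc]
            simp only
            rw [hlam]
            unfold desigV at hdes ⊢
            simp only at hdes ⊢
            rw [hlam]
            exact hdes
          · have := hQold v hv
            rw [stateOf_cons_of_some hq] at this
            exact this
      | bonus u =>
        obtain ⟨-, hu, hd, hY, hopen⟩ := nq_bonus_spec hq
        constructor
        · intro v hv
          rcases mem_A_hstep_bonus.1 hv with hv | ⟨ha, hv⟩
          · exact hAold v hv
          · by_cases hvA : v ∈ (stOf bs).A
            · exact hAold v hvA
            · rw [lamOf_cons, hq]
              simp only [ha, if_true, bonusLam, hvA, if_false, hv]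
              have hux : qmk Γ (lamOf S x₀ L N bs u) = u := ihA u hu
              have hdist : (Hq).dist (qmk Γ (lamOf S x₀ L N bs u)) v = r + 1 := by
                rw [hux]; rw [sphereF, Finset.mem_filter] at hv; exact hv.2
              obtain ⟨-, -, -, -, ht₁, ht₂, -⟩ := S.spec _ v hdist
              unfold pick
              split_ifs
              · exact ht₂
              · exact ht₁
        · intro v hv
          rw [Qd_hstep_bonus] at hv
          have := hQold v hv
          rw [stateOf_cons_of_some hq] at this
          exact this

/-- Lifts project to their vertices. [cite: MartineauSevero2019, §5 (Condition ⑤)] -/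
theorem qmk_lamOf (hG : G.Connected) (hact : IsActionByAut G Γ) {bs : List Bool}
    {v : MulAction.orbitRel.Quotient Γ V} (hv : v ∈ (stOf bs).A) : qmk Γ (lamOf S x₀ L N bs v) = v :=
  (inv_lift hG hact bs).1 v hv

/-- Designated lifts project onto their sites. [cite: MartineauSevero2019, §5 (Condition ①)] -/
theorem qmk_desig (hG : G.Connected) (hact : IsActionByAut G Γ) {bs : List Bool}
    {v : MulAction.orbitRel.Quotient Γ V} (hv : v ∈ (stOf bs).Qd) : qmk Γ (desig S x₀ L N bs v) = v :=
  ((inv_lift hG hact bs).2 v hv).1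

/-- The designated lift of a queried site is the lift of its source or adjacent to it. [cite: MartineauSevero2019, §5 (Condition ①)] -/
theorem desig_eq_or_adj (hG : G.Connected) (hact : IsActionByAut G Γ) {bs : List Bool}
    {v : MulAction.orbitRel.Quotient Γ V} (hv : v ∈ (stOf bs).Qd) :
    desig S x₀ L N bs v = lamOf S x₀ L N bs ((stOf bs).src v).1 ∨
      G.Adj (lamOf S x₀ L N bs ((stOf bs).src v).1) (desig S x₀ L N bs v) :=
  ((inv_lift hG hact bs).2 v hv).2

/-! ### The candidate vertices of a bonus -/

omit [(orbitQuotientGraph G Γ).LocallyFinite] in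
/-- Membership in `candPair`. [cite: MartineauSevero2019, §5 (Step 2K+2)] -/
theorem mem_candPair {x : V} {v : MulAction.orbitRel.Quotient Γ V} {t : V} :
    t ∈ candPair S x v ↔ t = S.tip₁ x v ∨ t = S.tip₂ x v := by
  simp [candPair]

/-- Membership in `cand`. [cite: MartineauSevero2019, §5 (Step 2K+2)] -/
theorem mem_cand {x : V} {u : MulAction.orbitRel.Quotient Γ V} {t : V} :
    t ∈ cand S x u ↔ t ∈ S.wt x ∨ ∃ v ∈ sphereF Hq u (r + 1), t ∈ candPair S x v := by
  simp [cand]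

omit [(orbitQuotientGraph G Γ).LocallyFinite] in
/-- The chosen candidate is one of the two tips. [cite: MartineauSevero2019, §5 (Step 2K+2)] -/
theorem pick_mem_candPair (σ : SHState (MulAction.orbitRel.Quotient Γ V)) (lam : MulAction.orbitRel.Quotient Γ V → V)
    (u v : MulAction.orbitRel.Quotient Γ V) : pick S σ lam u v ∈ candPair S (lam u) v := by
  unfold pick
  split_ifs <;> simp [candPair]

/-- **Every candidate lies near the lift**: a candidate `t` of a bonus at `u` lifted at `x` (with `π x = u`)
satisfies `t ∈ B_{3r+1}(x)` and `π t ∈ B_{r+1}(u)`. [cite: MartineauSevero2019, §5 (Z(x,r) ⊆ B_{3r}(x); S_{r+1}(u))] -/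
theorem cand_near (hG : G.Connected) {x : V} {u : MulAction.orbitRel.Quotient Γ V} (hux : qmk Γ x = u)
    {t : V} (ht : t ∈ cand S x u) : t ∈ graphBall G x (3 * r + 1) ∧ qmk Γ t ∈ graphBall Hq u (r + 1) := by
  have hH : (Hq).Connected := quot_connected hG
  rcases mem_cand.1 ht with ht | ⟨v, hv, ht⟩
  · obtain ⟨h1, h2⟩ := S.wt_ball x t ht
    exact ⟨graphBall_mono _ _ (by omega) h1, hux ▸ graphBall_mono _ _ (by omega) h2⟩
  · rw [sphereF, Finset.mem_filter] at hv
    have hdist : (Hq).dist (qmk Γ x) v = r + 1 := by rw [hux]; exact hv.2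
    obtain ⟨-, -, -, -, ht₁, ht₂, ha₁, ha₂, -, hf₁, hf₂, -, -⟩ := S.spec x v hdist
    have htv : qmk Γ t = v := by
      rcases mem_candPair.1 ht with rfl | rfl
      · exact ht₁
      · exact ht₂
    refine ⟨?_, ?_⟩
    · rcases mem_candPair.1 ht with rfl | rfl
      · exact mem_graphBall_trans (S.wt_ball x _ hf₁).1 (mem_graphBall_one_of_adj' ha₁)
      · exact mem_graphBall_trans (S.wt_ball x _ hf₂).1 (mem_graphBall_one_of_adj' ha₂)
    · rw [htv, ← hux]; exact mem_graphBall_of_dist_le hH hdist.le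

/-- **At a bonus, every candidate projects to a QUERIED site** (no site query was available: every site of
`B_{r+1}(u)` around the explored, queried-open ball `B_r(u)` with `d(o,u) < L` is queried).
[cite: MartineauSevero2019, §5 (Condition ②: "If an edge e is p-unexplored, then all of its lifts are unexplored")] -/
theorem cand_proj_mem_Qd (hG : G.Connected) (hact : IsActionByAut G Γ) {bs : List Bool}
    {u : MulAction.orbitRel.Quotient Γ V} (hq : nq Hq (qmk Γ x₀) r L (stOf bs) = some (Query.bonus u))
    {t : V} (ht : t ∈ cand S (lamOf S x₀ L N bs u) u) : qmk Γ t ∈ (stOf bs).Qd := by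
  have hH : (Hq).Connected := quot_connected hG
  obtain ⟨hnone, hu, hd, hY, hopen⟩ := nq_bonus_spec hq
  have hinv := inv_stateOf (H := Hq) (o := qmk Γ x₀) (r := r) (L := L) (N := N) hH bs
  have hux : qmk Γ (lamOf S x₀ L N bs u) = u := qmk_lamOf hG hact hu
  -- every vertex of `B_r(u)` is explored (queried-open) and queried
  have hballQ : ∀ w ∈ graphBall Hq u r, w ∈ (stOf bs).A ∧ w ∈ (stOf bs).Qd := by
    intro w hw
    have hwA : w ∈ (stOf bs).A := hinv.O_A w (hopen w (mem_ballFin.2 hw))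
    refine ⟨hwA, ?_⟩
    by_contra hwQ
    refine hnone ⟨(w, w), hwA, Or.inl rfl, ?_, hwQ⟩
    have := dist_le_of_mem_graphBall hw
    have := hH.dist_triangle (u := qmk Γ x₀) (v := u) (w := w)
    show (Hq).dist (qmk Γ x₀) w < L + r
    omega
  rcases mem_cand.1 ht with ht | ⟨v, hv, ht⟩
  · have h2 := (S.wt_ball _ t ht).2
    rw [hux] at h2
    exact (hballQ _ h2).2
  · rw [sphereF, Finset.mem_filter] at hv
    have hdist : (Hq).dist (qmk Γ (lamOf S x₀ L N bs u)) v = r + 1 := by rw [hux]; exact hv.2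
    obtain ⟨hbase, hbv, -, -, ht₁, ht₂, -⟩ := S.spec _ v hdist
    rw [hux] at hbase
    have hbaseB : S.base (lamOf S x₀ L N bs u) v ∈ graphBall Hq u r := mem_graphBall_of_dist_le hH hbase.le
    obtain ⟨hbA, -⟩ := hballQ _ hbaseB
    have htv : qmk Γ t = v := by
      rcases mem_candPair.1 ht with rfl | rfl
      · exact ht₁
      · exact ht₂
    rw [htv]
    by_contra hvQ
    refine hnone ⟨(S.base (lamOf S x₀ L N bs u) v, v), hbA, Or.inr hbv, ?_, hvQ⟩
    show (Hq).dist (qmk Γ x₀) (S.base (lamOf S x₀ L N bs u) v) < L + r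
    have := hH.dist_triangle (u := qmk Γ x₀) (v := u) (w := S.base (lamOf S x₀ L N bs u) v)
    omega

end Lift

end SiteCoupling

end Literature.Probability.Percolation
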